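import Summits.BirchSwinnertonDyer.Rank1Residual.Ordinary.KuriharaExactOrderVocabulary
import Summits.BirchSwinnertonDyer.Rank1Residual.Ordinary.CyclicSylowDivisibility
import Literature.NumberTheory.EllipticCurves.ComplexMultiplicationCoatesWilesReductionIndexProofs
import HarnessLib

/-!
# The class of `c·x` modulo `p^k` in a finite abelian group with cyclic `p`-Sylow: `c·x ∈ p^k·G ⟺
# p^{k − v(x)} ∣ c` (`v(x)` = the divisibility exponent) — on `Ẽ(𝔽_ℓ)`: the class of `c·P̄` in
# `Ẽ(𝔽_ℓ)/p^k` has divisibility exponent `min(k, v_p(c) + v_ℓ(P))`, the `ℓ`-side local input of the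
# depth-law derivation (PROVED)

HONEST FRAMING (cell `b2b-bsdres`, run/shared/lean/b2b/bsd-rank1-residual/, verbatim in every
file): the goal of the cell is to DELETE the COMBINATION-SHAPED residual classes of the
Birch–Swinnerton-Dyer formula for ALL analytic-rank `≤ 1` elliptic curves over `ℚ` — "full BSD
formula for every rank `≤ 1` curve in class `C`" assembled STRICTLY from published theorems — so
that the rank-`≤ 1` remainder becomes exactly the CONSTRUCTION-SHAPED classes, which are TYPED
(missing-input `Prop`s), NOT attempted. This is not "finishing BSD". Seat `b2b-bsdres-additive-p3`
(typer-designate for the cell conjecture C-16, hyp R-16 (e)). THEOREMS ONLY (finite abelian groups and the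
reduction `Ẽ(𝔽_ℓ)`; no definition, no named fact); nothing about any particular curve is asserted,
nothing is booked, no mark / label / count / tier moves; C-16 stays a CONJECTURE (data-suggested, never
theorem). Siblings: `Ordinary/CyclicSylowDivisibility.lean` (the divisibility exponent in the cyclic case is
`e − v_p(ord x)`), `Ordinary/KuriharaExactOrderVocabulary.lean` (`localDivExponent` = `v_ℓ(P)`); the `p`-side
twin (the class of `P` in `E(ℚ_p)/p^k` is `p^{min(k, m_p)}` × generator) is `Ordinary/LocalPointsModPrimePower.lean`.

## Why this file

The derivation of the rank-one depth law (`HOME/b2b-bsdres-additive-p3/R1-DEPTH-LAW.md` §2 (ii)–(iii); hyp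
`SHARPENED-CONJECTURES.md` §120 D94.3) uses at the Kolyvagin prime `ℓ`: «`H¹_f(ℚ_ℓ, E[p^{k′}]) =
E(𝔽_ℓ)/p^{k′} ≅ ℤ/p^{k′}` (free of rank one at a cyclic depth-`k′` prime), and `loc_ℓ κ₁ = p^a·u·P̄` has
order-exponent `min(k′, a + v)`, `v = v_ℓ(P)`». The cohomological identification is not typed; the
group-theoretic content is proved here:

* §1 (`G` finite abelian, `p` prime, `#G[p] ≤ p`, `e = v_p #G`, `k ≤ e`, `c ∈ ℕ`):
  **`(∃ y, p^k • y = c • x) ⟺ p^{k − (e − v_p(ord x))} ∣ c`** — the class of `c·x` in `G/p^k·G` is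
  `p^k`-divisible iff `p^{k − v(x)} ∣ c`, where `v(x) = e − v_p(ord x)` is `x`'s divisibility exponent
  (sibling); i.e. the class of `x` in `G/p^k·G ≅ ℤ/p^k` is `p^{min(k, v(x))}` times a generator. (`⟸`:
  `x = p^{v(x)} • y₀` by the sibling; `⟹`: `ord x ∣ c · ord(c•x)` and the sibling's bound
  `v_p(ord(c • x)) + k ≤ e`.)
* §2 (good `ℓ ≠ p` with `#Ẽ(𝔽_ℓ)[p] ≤ p` on the residue field, `k ≤ e_ℓ = v_p #Ẽ(𝔽_ℓ)`):
  **`(∃ Q̄, p^k • Q̄ = c • P̄) ⟺ p^{k − v_ℓ(P)} ∣ c`** with `v_ℓ(P) = localDivExponent W p ℓ P` — the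
  class of `c·P̄` in `Ẽ(𝔽_ℓ)/p^k` has divisibility exponent `min(k, v_p(c) + v_ℓ(P))`; for `c = p^a·u`
  (`p ∤ u`) this is the printed «order-exponent `min(k′, a + v)`».

References: standard (finite abelian groups); J. H. Silverman, AEC 2nd ed. (2009), VII.2.1 / IV.2.3 for the
reduction dictionary (through the siblings) [SilvermanAEC2009]; hyp §120 D94.3; additive-p3 `R1-DEPTH-LAW.md`
§2 (ii)–(iii).
-/

noncomputable section

open scoped Classical

open WeierstrassCurve Literature.NumberTheory.EllipticCurves

namespace Summit.BirchSwinnertonDyer.Rank1Residual.Ordinary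

/-! ### §1 Finite abelian groups with `#G[p] ≤ p`: `c • x ∈ p^k G ⟺ p^{k − v(x)} ∣ c` -/

section Group

variable {G : Type*} [AddCommGroup G] [Finite G] {p : ℕ} [hp : Fact p.Prime]

/-- `ord x ∣ c · ord(c • x)`, hence `v_p(ord x) ≤ v_p(c) + v_p(ord(c • x))` for `c ≠ 0`. [folklore] -/
theorem padicValNat_addOrderOf_le_add_padicValNat_addOrderOf_smul {c : ℕ} (hc : c ≠ 0) (x : G) :
    padicValNat p (addOrderOf x) ≤ padicValNat p c + padicValNat p (addOrderOf (c • x)) := by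
  have hd' : addOrderOf (c • x) ≠ 0 := (addOrderOf_pos _).ne'
  have hdvd : addOrderOf x ∣ c * addOrderOf (c • x) := by
    rw [addOrderOf_dvd_iff_nsmul_eq_zero, mul_comm, mul_smul]
    exact addOrderOf_nsmul_eq_zero (c • x)
  have hne : c * addOrderOf (c • x) ≠ 0 := mul_ne_zero hc hd'
  rw [← padicValNat.mul hc hd', ← padicValNat_dvd_iff_le hne]
  exact pow_padicValNat_dvd.trans hdvd

/-- **The class of `c • x` modulo `p^k`**: in a finite abelian group with `#G[p] ≤ p` (cyclic `p`-Sylow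
subgroup), for `k ≤ e = v_p #G` and `c ∈ ℕ`: **`(∃ y, p^k • y = c • x) ⟺ p^{k − (e − v_p(ord x))} ∣ c`**,
where `e − v_p(ord x)` is the divisibility exponent of `x` (sibling
`findGreatest_pow_smul_eq_sub_padicValNat_addOrderOf`): the class of `x` in `G/p^k G ≅ ℤ/p^k` is
`p^{min(k, e − v_p(ord x))}` times a generator. [folklore] -/
theorem exists_pow_smul_eq_smul_iff_pow_sub_dvd (hcyc : Nat.card {x : G // p • x = 0} ≤ p)
    {k : ℕ} (hk : k ≤ padicValNat p (Nat.card G)) (x : G) (c : ℕ) :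
    (∃ y : G, p ^ k • y = c • x) ↔
      p ^ (k - (padicValNat p (Nat.card G) - padicValNat p (addOrderOf x))) ∣ c := by
  have hpp : p.Prime := hp.out
  set e := padicValNat p (Nat.card G) with he
  set vx := padicValNat p (addOrderOf x) with hvx
  have hvxe : vx ≤ e := by
    have h := findGreatest_pow_smul_add_padicValNat_addOrderOf_le (p := p) x
    rw [← he, ← hvx] at h
    omega
  constructor
  · rintro ⟨y, hy⟩
    rcases eq_or_ne c 0 with rfl | hc
    · exact dvd_zero _
    -- `v_p(ord(c • x)) + k ≤ e` and `vx ≤ v_p(c) + v_p(ord(c • x))`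
    have h1 := padicValNat_addOrderOf_add_le_of_pow_smul_eq (p := p) hk hy
    have h2 := padicValNat_addOrderOf_le_add_padicValNat_addOrderOf_smul (p := p) hc x
    rw [← he] at h1
    rw [← hvx] at h2
    rw [padicValNat_dvd_iff_le hc]
    omega
  · intro hdvd
    -- `x = p^(e - vx) • y₀` (the divisibility exponent is attained)
    obtain ⟨y₀, hy₀⟩ := exists_pow_smul_eq_of_padicValNat_addOrderOf_add_le hcyc (j := e - vx) (x := x)
      (by rw [← hvx, ← he]; omega)
    rcases le_or_gt (e - vx) k with hle | hlt
    · -- `k ≥ v(x)`: `c = p^(k - v(x)) c'`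
      obtain ⟨c', rfl⟩ := hdvd
      refine ⟨c' • y₀, ?_⟩
      rw [← hy₀, smul_smul, smul_smul]
      congr 1
      rw [mul_comm (p ^ (k - (e - vx))) c', mul_assoc, ← pow_add, Nat.sub_add_cancel hle, mul_comm]
    · -- `k < v(x)`: `x ∈ p^{v(x)} G ⊆ p^k G`
      refine ⟨(c * p ^ (e - vx - k)) • y₀, ?_⟩
      rw [← hy₀, smul_smul, smul_smul]
      congr 1
      rw [mul_comm c, ← mul_assoc, ← pow_add, Nat.add_sub_cancel' hlt.le, mul_comm]

end Group

/-! ### §2 On the reduction: the class of `c·P̄` in `Ẽ(𝔽_ℓ)/p^k` has exponent `min(k, v_p(c) + v_ℓ(P))` -/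

section Reduction

variable (W : WeierstrassCurve ℚ) [W.IsElliptic] [W.IsGloballyMinimal] (p ℓ : ℕ) [Fact p.Prime]
  [Fact ℓ.Prime]

/-- **`(∃ Q̄, p^k • Q̄ = c • P̄) ⟺ p^{k − v_ℓ(P)} ∣ c`** at a good prime `ℓ ≠ p` whose reduction has
cyclic `p`-torsion on the residue field (`#Ẽ(𝔽_ℓ)[p] ≤ p`), for `k ≤ e_ℓ = v_p #Ẽ(𝔽_ℓ)` and `c ∈ ℕ`, with
`v_ℓ(P) = localDivExponent W p ℓ P` (= `e_ℓ − v_p(ord P̄)` here, siblings) and `P̄` the reduction of `P`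
read on the residue field of `ℤ_ℓ` as in the vocabulary file: the class of `c·P̄` in `Ẽ(𝔽_ℓ)/p^k ≅ ℤ/p^k`
is `p^{min(k, v_p(c) + v_ℓ(P))}` times a generator — for `c = p^a·u`, `p ∤ u`, the printed «`p^a·u·P̄` has
order-exponent `min(k, a + v)`». [cite: SilvermanAEC2009, Prop. VII.2.1 and Prop. IV.2.3] -/
theorem exists_pow_smul_eq_smul_reduction_iff_pow_sub_localDivExponent_dvd
    (hgood : ¬ (ℓ : ℤ) ∣ minimalDiscriminantInt W) (hℓp : ℓ ≠ p)
    (hcyc : Nat.card {c : (((integralModelInt W).map (Int.castRingHom ℤ_[ℓ])).map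
      (IsLocalRing.residue ℤ_[ℓ])).toAffine.Point // p • c = 0} ≤ p)
    (P : W.toAffine.Point) {k : ℕ} (hk : k ≤ padicValNat p (W.reductionPointCount ℓ)) (c : ℕ) :
    (∃ Q : (((integralModelInt W).map (Int.castRingHom ℤ_[ℓ])).map
        (IsLocalRing.residue ℤ_[ℓ])).toAffine.Point,
      p ^ k • Q = c • reducePoint ((integralModelInt W).map (Int.castRingHom ℤ_[ℓ]))
        (Affine.Point.congrEquiv (W.padicModel_baseChange ℓ).symm
          (Affine.Point.map (W' := W.toAffine) (Algebra.ofId ℚ ℚ_[ℓ]) P))) ↔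
      p ^ (k - localDivExponent W p ℓ P) ∣ c := by
  haveI : Finite (((integralModelInt W).map (Int.castRingHom ℤ_[ℓ])).map
      (IsLocalRing.residue ℤ_[ℓ])).toAffine.Point :=
    Nat.finite_of_card_ne_zero (by
      rw [W.natCard_point_padicModel_residue ℓ, reductionPointCount]
      haveI : NeZero ℓ := ⟨(Fact.out : ℓ.Prime).ne_zero⟩
      exact Nat.card_pos.ne')
  have hv : localDivExponent W p ℓ P = padicValNat p (W.reductionPointCount ℓ) -
      padicValNat p (addOrderOf (reducePoint ((integralModelInt W).map (Int.castRingHom ℤ_[ℓ]))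
        (Affine.Point.congrEquiv (W.padicModel_baseChange ℓ).symm
          (Affine.Point.map (W' := W.toAffine) (Algebra.ofId ℚ ℚ_[ℓ]) P)))) := by
    rw [localDivExponent_eq_findGreatest_reduction W p ℓ hgood (Fact.out) hℓp P,
      ← W.natCard_point_padicModel_residue ℓ]
    exact findGreatest_pow_smul_eq_sub_padicValNat_addOrderOf hcyc _
  rw [hv]
  rw [← W.natCard_point_padicModel_residue ℓ] at hk ⊢
  exact exists_pow_smul_eq_smul_iff_pow_sub_dvd hcyc hk _ c

end Reduction

end Summit.BirchSwinnertonDyer.Rank1Residual.Ordinary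

end
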